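import Summits.BirchSwinnertonDyer.BirchSwinnertonDyer.Theorems.Rank2Observatory2DescClRealSubCurveCertSDefs
import HarnessLib

/-!
# BirchSwinnertonDyer — rank ≥ 2 observatory: KERNEL-2DESC-CL v3.0rk — the TOTALLY REAL split-2 kill-list certificate in COUNT form, part 1/2: the checker

HONEST FRAMING: per-curve certified theorems and census instruments; no claim on BSD in rank ≥ 2.

Part 1 of 2.  The totally real twin of `Rank2Observatory2DescClKillCurveCertSDefs` (v3.0k, COUNT form):
`checkRSK G ccr r ks` = the clauses of the totally real split-2 checker `checkRS G ccr r`
(`Rank2Observatory2DescClRealCurveCertSDefs`) VERBATIM except its final count, followed by the light kill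
clauses (`ClKillS.lite` on the underlying signature-free records `G.toS2`, `ccr.cc`) and the STRICT COUNT of
v3.0k: fewer than `2 ^ (r + 1)` classes pass the sieve `admRSK G ccr ks` (`admRS` AND none of the killed classes;
`Rank2Observatory2DescClRealSubCurveCertSDefs`).  No survivor list, no subgroup search: the kernel cost of a row
is `2 ^ n` evaluations of `admRSK` (`n = #family`) plus the kills' `lite` clauses — the shape of the complex
v3.0k rows — which is what a totally real rank-`3` row with ONE killed class needs (the merged layer `checkRSKS`
of v3.0rks runs the `noSubB` search at depth `r + 1 = 4`, whose kernel evaluation exceeds the memory ceiling on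
such rows: cert-2 WAVE-10, `PROPOSAL-RSK-count-layer.md`).  The residue searches `killSearchS G.toS2 ccr.cc ks`
stay a separate hypothesis.  Soundness (`rank_le_of_checkRSK`) is part 2.

New declarations only; nothing landed or staged is touched.  Sorry-free; axioms `propext`, `Classical.choice`,
`Quot.sound`.

[cite: Cassels1991LecturesEllipticCurves, §15] [cite: CremonaAlgorithms1997, §3.6]
-/

set_option linter.dupNamespace false

noncomputable section

open scoped Classical NumberField nonZeroDivisors

open Literature.NumberTheory.NumberFields Polynomial Module NumberField IsDedekindDomain Ideal

namespace Summit.BirchSwinnertonDyer.BirchSwinnertonDyer.Rank2Observatory.TwoDescCl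

open TwoDescCubic ClFieldCert TwoDescKill

section Checkers

variable (G : ClFieldCertRS2) (ccr : ClCurveCertSR)

/-- **The totally real split-2 per-curve `r`-checker with a kill list in COUNT form**: the clauses of
`checkRS G ccr r` except its count, verbatim; then the light kill clauses and the strict count — fewer than
`2 ^ (r + 1)` classes pass `admRSK G ccr ks`.  Computable; run by `decide +kernel`.
[cite: Cassels1991LecturesEllipticCurves, §15] [cite: CremonaAlgorithms1997, §3.6] -/
def checkRSK (r : ℕ) (ks : List ClKillS) : Bool :=
  decide (deltaShort ccr.cc.A ccr.cc.B ccr.cc.C ≠ 0) &&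
    noRootMod ccr.cc.pF ccr.cc.A ccr.cc.B ccr.cc.C &&
    decide (cubicAtCoords G.toS2.fs.base.a G.toS2.fs.base.b G.toS2.fs.base.c ((G.toS2.m₁ : ℤ) * ccr.cc.A)
      ((G.toS2.m₁ : ℤ) ^ 2 * ccr.cc.B) ((G.toS2.m₁ : ℤ) ^ 3 * ccr.cc.C) ccr.cc.Xt = (0, 0, 0)) &&
    decide (derivAtCoords G.toS2.fs.base.a G.toS2.fs.base.b G.toS2.fs.base.c ((G.toS2.m₁ : ℤ) * ccr.cc.A)
      ((G.toS2.m₁ : ℤ) ^ 2 * ccr.cc.B) ccr.cc.Xt =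
      MonicCubic.mulCoords G.toS2.fs.base.a G.toS2.fs.base.b G.toS2.fs.base.c
        (smulCoords (G.toS2.m₁ : ℤ) ccr.cc.XD)
        (prodPowCoords G.toS2.fs.base.a G.toS2.fs.base.b G.toS2.fs.base.c [])) &&
    (fracOf G.toS2 ccr.cc.Xt ccr.cc.tsnT).check G.toS2.fs.base.a G.toS2.fs.base.b G.toS2.fs.base.c &&
    (fracOf G.toS2 ccr.cc.XD ccr.cc.tsnD).check G.toS2.fs.base.a G.toS2.fs.base.b G.toS2.fs.base.c &&
    decide (0 < MonicCubic.disc ccr.cc.A ccr.cc.B ccr.cc.C) &&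
    decide (normFormZ G.toS2.fs.base.a G.toS2.fs.base.b G.toS2.fs.base.c ccr.cc.XD.1 ccr.cc.XD.2.1
      ccr.cc.XD.2.2 ≠ 0) &&
    decide ((normFormZ G.toS2.fs.base.a G.toS2.fs.base.b G.toS2.fs.base.c ccr.cc.XD.1 ccr.cc.XD.2.1
      ccr.cc.XD.2.2).natAbs = (ccr.cc.dn.map fun pe => pe.1 ^ pe.2).prod) &&
    (ccr.cc.dn.all fun pe => primeDispatchS G.toS2 ccr.cc (fracOf G.toS2 ccr.cc.XD ccr.cc.tsnD) ccr.cc.XD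
      ccr.cc.dinvA ccr.cc.dmiss2 pe.1) &&
    (ccr.cc.codes.all fun bc => codeClauseS G.toS2 ccr.cc bc) &&
    invCert G.toS2.fs.base.a G.toS2.fs.base.b G.toS2.fs.base.c G.toS2.fs.base.w₁ ccr.cc.XD ccr.cc.dW1 &&
    invCert G.toS2.fs.base.a G.toS2.fs.base.b G.toS2.fs.base.c G.toS2.fs.base.w₂ ccr.cc.XD ccr.cc.dW2 &&
    (ccr.cc.Q.all fun q => decide (0 < q)) &&
    decide (ccr.cc.head.length = 5) &&
    ((famS ccr.cc).all fun f => famCheckSR G ccr f) &&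
    (linLtCond (G.fr.I ccr.o₀).1 (G.fr.I ccr.o₀).2 (G.fr.I ccr.o₁).1 (G.fr.I ccr.o₁).2 ccr.cc.Xt &&
      linLtCond (G.fr.I ccr.o₁).1 (G.fr.I ccr.o₁).2 (G.fr.I ccr.o₂).1 (G.fr.I ccr.o₂).2 ccr.cc.Xt) &&
    decide (∀ T : Finset (Fin (famS ccr.cc).length), T ≠ ∅ →
      ∃ k : Fin (G.toS2.fs.base.chars.length + 5), Odd (T.filter fun j => bitRS G ccr k j = true).card) &&
    (ks.all fun k => k.lite G.toS2 ccr.cc) &&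
    decide (((Finset.univ ×ˢ Finset.univ).filter
      (fun p : Finset (Fin 0) × Finset (Fin (famS ccr.cc).length) => admRSK G ccr ks p.1 p.2 = true)).card <
      2 ^ (r + 1))

end Checkers

end Summit.BirchSwinnertonDyer.BirchSwinnertonDyer.Rank2Observatory.TwoDescCl

end
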